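import Mathlib
import Literature.Computability.Complexity.Classes
import Literature.Computability.Complexity.Circuit
import Literature.Computability.Complexity.CircuitClasses
import Literature.Computability.MetaComplexity.MCSP
import Literature.Computability.MetaComplexity.LevinKt
import Literature.Computability.MetaComplexity.FormulaModelsAE
import Literature.Computability.MetaComplexity.ChenJinWilliams2019.SparseMagnification
import Literature.Computability.MetaComplexity.ChenJinWilliams2019.SparseFormulaMagnification
import Literature.Computability.MetaComplexity.ChenJinWilliams2020.SparseProbabilisticFormulas
import Literature.Computability.MetaComplexity.ChenJinWilliams2020.ExplicitObstructions
import Literature.Computability.MetaComplexity.OliveiraSanthanam2018.ApproxMCSPFormulaMagnification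
import HarnessLib

/-!
# Chen–Jin–Williams 2019, §1.1.2: hardness magnification for ZERO-ERROR HEURISTICS
# (Theorem 1.9 — sparse `NP` languages; Theorem 1.10 — `MCSP[s(m)]`, `MKtP[p(n)]`) as named facts,
# with the definition of zero-error average-case solvability by circuits (D11)

Citation header. L. Chen, C. Jin, R. R. Williams, *Hardness Magnification for all Sparse NP
Languages*, FOCS 2019, 1240–1255, doi:10.1109/FOCS.2019.00077 [bib: `ChenJinWilliams2019`]; full
version ECCC TR19-118 (read: `lit read "https://eccc.weizmann.ac.il/report/2019/118/download/"`,
materialised as `paper:url-28b8c177f29e`, 26 pp.; theorem numbering identical with the proceedings,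
cf. `SparseMagnification.lean`). All quotations below are from that text layer (pp. 6, 16, 17).

**The notion (p. 6, verbatim; repeated p. 16, §4.3).** *"A (zero-error) average-case algorithm A for
a function f : {0,1}ⁿ → {0,1} is a deterministic algorithm that always outputs a value in {0, 1, ?},
such that A is never incorrect and A outputs ? with probability at most 1/n over uniform random
n-bit inputs. (To implement this output behavior in Boolean circuits, we let the circuit output two
bits encoding 0, 1, or ?.)"*

**Theorem 1.9 (p. 6, verbatim).** *"Let 𝒞 be any circuit class (e.g., 𝒞 could be Circuit, Formula,
AC⁰[6], etc.). If there is an ε > 0 and a family of languages {L_β} (indexed over β ∈ (0,1)) such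
that L_β is a 2^{n^β}-sparse NP language not solvable on average with zero error by 𝒞-circuits of
size n^ε for all β, then NP ⊄ 𝒞[nᵏ] for all k."*

**Theorem 1.10 (p. 6, verbatim).** *"Let 𝒞 be any circuit class (e.g., 𝒞 = Circuit, Formula, or
AC⁰[6]). • Let s(m) ≥ m. If MCSP[s(m)] on input length n = 2^m cannot be solved on average with zero
error by 𝒞[poly(s(m))], then NP ⊄ 𝒞[poly(n)]. • Let p(n) ≥ log n. If MKtP[p(n)] cannot be solved
on average with zero error by 𝒞[poly(p(n))], then EXP ⊄ 𝒞[poly(n)]."*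

Proofs in print (p. 16–17): a `2^t`-sparse `NP` language `L` has the `NP` "prefix oracle"
`H_t(h) = [∃ x ∈ L_n, x[1..t] = h]`; under `NP ⊂ 𝒞[nᵏ]` it has `tᵏ < n^ε`-size `𝒞`-circuits, and
"return 0 if `H_t(x[1..t])` rejects, ? otherwise" is never wrong and says ? with probability
`≤ 2^{n^β}/2^t ≤ 1/n`; for `MCSP[s(m)]` the sparsity is `2^{100 s(m) log s(m)}`, for `MKtP[p(n)]` the
oracle is in `EXP`.

## What is vendored

* **D11** `ZeroErrorSolves v d g` — a PAIR of Boolean functions (value `v`, definedness flag `d`;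
  `d x = false` encodes the answer "?") solves `g : {0,1}ⁿ → {0,1}` on average with zero error:
  `∀ x, d x = true → v x = g x` (never incorrect) and `n · #{x | d x = false} ≤ 2ⁿ` (the exact
  integer form of "Pr[?] ≤ 1/n"). `ZESolvableAt 𝒞 L n` — at length `n`, some `v, d` from the
  length-indexed class of Boolean FUNCTIONS `𝒞 n` (the classes of `ExplicitObstructions.lean`:
  `circuitFns`, `deMorganFormulaFns`, …, and the new `b2CircuitFns s` = functions with a
  `B₂`-circuit of `≤ s n` gates) zero-error-solve the slice `sliceFn L n`.
* Thm. 1.9 for `𝒞 = Circuit` (`thm19_circuit_NP`) and `𝒞 = Formula` (`thm19_formula_NP`), `C = NP`;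
  Thm. 1.10, both bullets, for `𝒞 = Circuit` (`thm110_MCSP_circuit`, `thm110_MKtP_circuit`) and
  `𝒞 = Formula` (`thm110_MCSP_formula`, `thm110_MKtP_formula`). The `AC⁰[6]` instances are not
  typed (no `AC⁰[m]`-by-size function classes in the tree at this granularity).
* PROVED sanity/API: worst-case solvability ⇒ zero-error solvability (`ZeroErrorSolves.of_eq`,
  `zeSolvableAt_of_mem`), hence zero-error HARDNESS ⇒ worst-case hardness in any class containing the
  constant `true` (`not_mem_of_not_zeSolvableAt`); "?" everywhere is not a solution for `n ≥ 2`
  (`ZeroErrorSolves.exists_defined`); monotonicity in the class (`ZESolvableAt.mono`); the empty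
  language is zero-error-solvable by one-gate `B₂`-circuits and by two-leaf De Morgan formulas
  (`zeSolvableAt_zero_b2`, `zeSolvableAt_zero_deMorgan`) — so the sparse-language hypotheses below are
  not met by the trivial sparse `NP` language `∅` (referee rule F1: no vacuous antecedent by
  emptiness of the device class).

## Rendering choices, and why each typed statement is implied by (never stronger than) print

(i) "solvable on average with zero error by 𝒞-circuits of size S" is typed BROADLY: a pair of
single-output devices of the class, each within the size bound, at all sufficiently large lengths
(`∀ᶠ n`); a two-output device of size `S` yields such a pair (its two output sub-devices have size
`≤ S`), and "all n" implies "all large n". Hence the typed NEGATION (the hypothesis of each fact) is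
at least as strong as the printed hypothesis, and the typed implication follows from the printed
one. (ii) Size bounds with constants, as in `SparseMagnification.lean` (i): "size n^ε" is rendered
`c·⌈n^ε⌉ + c` with a PER-LANGUAGE constant quantified inside the negation (`∀ c, ¬ ∀ᶠ n, …` = "not
solvable in size `O(n^ε)`", which implies "not solvable in size `n^ε`" infinitely often);
"poly(s(m))" is rendered `s(m)ᵏ + k` (`∃ k` inside the negated solvability; every polynomial is
eventually below some `sᵏ + k`, and `+ k` absorbs the `O(1)` gates of re-encoding `{0,1,?}`).
(iii) Conclusions are the tree's robust renderings already used for this paper and for OS18: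
`NPNotInFixedPolySize` (`SparseMagnification.lean`), `ChenJinWilliams2020.NPNotInFixedPolyFormulas`,
`¬ (NP ⊆ PPoly)`, `OliveiraSanthanam2018.NPNotInFormulaPoly`, `¬ (EXP ⊆ PPoly)`, and the `EXP`
twin `EXPNotInFormulaPoly` defined here; that the printed conclusions imply them is the absorption
argument of `SparseMagnification.lean` (i) (fixed-polynomial case) resp. immediate (the `poly` case:
"`NP ⊄ 𝒞[poly(n)]`" says some `L ∈ NP` is outside `𝒞[nᶜ]` for every `c`). (iv) `MCSP[s(m)]` is the
tree's `MCSPSize s` (`s` indexed by the arity `m`, input length `n = 2^m`, `B₂` gates — the paper's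
"circuit" is fan-in two, p. 9), so solvability is asserted at the lengths `2^m` only (other lengths
carry no instances); `MKtP[p(n)]` is `U.MKtP p` of `LevinKt.lean` (whole-output `Kt`, the convention
of Def. 2.2 of the paper, as in `OliveiraSanthanam2018/MKtPCircuitMagnification.lean`), over a fixed
universal machine `U`. (v) Side conditions: "s(m) ≥ m" verbatim; "p(n) ≥ log n" as
`Nat.clog 2 n ≤ p n` (the ceiling makes the typed premise imply the printed one under either reading
of `log`). (vi) `Formula` = De Morgan formulas measured by leaves (`deMorganFormulaFns`, as
`FORMULAae`); the paper's formulas are over `U₂`/`B₂` with size = leaves up to constants (p. 9), a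
difference absorbed on the hypothesis side by (ii)'s constants only up to the usual `O(1)` factor
between `B₂`- and De Morgan-formula size for the SAME function — we therefore type the formula
instances over De Morgan formulas on BOTH sides (hypothesis class and conclusion class), the reading
under which the printed proof (p. 16–17: plug the `𝒞`-circuits for `H_t` into an AND with literals)
is literal for `𝒞` = De Morgan formulas.

Typed, not proved: every `def … : Prop` fact below is a hypothesis for users (`(h : thm19_circuit_NP)`).
-/

namespace Literature.Computability.MetaComplexity.ChenJinWilliams2019

open Finset Filter _root_.Computability Literature.Computability.Complexity
open Literature.Computability.Complexity.Nondeterministic Literature.Computability.MetaComplexity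

/-! ### D11 — zero-error average-case solvability -/

/-- **D11.** The pair (value function `v`, definedness flag `d`; `d x = false` means the answer
"?") *solves `g` on average with zero error*: it is never incorrect where it answers, and it answers
"?" on at most a `1/n` fraction of the `2ⁿ` inputs (`n · #{x | d x = false} ≤ 2ⁿ`).
[cite: ChenJinWilliams2019, §1.1.2 (p. 6) and §4.3 (zero-error average-case algorithms)] -/
def ZeroErrorSolves {n : ℕ} (v d g : (Fin n → Bool) → Bool) : Prop :=
  (∀ x, d x = true → v x = g x) ∧ n * (univ.filter fun x => d x = false).card ≤ 2 ^ n

/-- `L` is *solvable on average with zero error at length `n` by the class `𝒞`* (a length-indexed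
class of Boolean functions, e.g. "functions with a `B₂`-circuit of `≤ s n` gates"): some value
function and some flag function from `𝒞 n` zero-error-solve the slice of `L`.
[cite: ChenJinWilliams2019, §1.1.2 ("we let the circuit output two bits encoding 0, 1, or ?")] -/
def ZESolvableAt (𝒞 : ∀ n : ℕ, Set ((Fin n → Bool) → Bool)) (L : Language Bool) (n : ℕ) : Prop :=
  ∃ v ∈ 𝒞 n, ∃ d ∈ 𝒞 n, ZeroErrorSolves v d (ChenJinWilliams2020.sliceFn L n)

/-- Functions computed by `B₂`-circuits with at most `s n` GATES at length `n` (the paper's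
`Circuit[s]`, Def. 2.1: fan-in-two circuits, size = gates). [cite: ChenJinWilliams2019, §2.1 (Circuit[s])] -/
def b2CircuitFns (s : ℕ → ℕ) : ∀ n : ℕ, Set ((Fin n → Bool) → Bool) :=
  ChenJinWilliams2020.circuitFns fun n C => C.IsOver B2 ∧ C.size ≤ s n

/-! ### API for D11 (all proved) -/

namespace ZeroErrorSolves

variable {n : ℕ} {v d g : (Fin n → Bool) → Bool}

/-- A worst-case solution is a zero-error solution (flag constantly `true`, no "?" at all). [folklore] -/
theorem of_eq (h : ∀ x, v x = g x) : ZeroErrorSolves v (fun _ => true) g :=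
  ⟨fun x _ => h x, by simp⟩

/-- Never incorrect where defined. [folklore] -/
theorem correct (h : ZeroErrorSolves v d g) {x : Fin n → Bool} (hx : d x = true) : v x = g x :=
  h.1 x hx

/-- For `n ≥ 2` a zero-error solution must answer somewhere: the all-"?" pair is not a solution.
[folklore] -/
theorem exists_defined (h : ZeroErrorSolves v d g) (hn : 2 ≤ n) : ∃ x, d x = true := by
  by_contra hno
  push Not at hno
  have hall : (univ.filter fun x : Fin n → Bool => d x = false) = univ := by
    apply Finset.filter_true_of_mem
    intro x _
    simpa using hno x
  have h2 := h.2
  rw [hall, Finset.card_univ, Fintype.card_fun, Fintype.card_bool, Fintype.card_fin] at h2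
  have hpos : 0 < 2 ^ n := Nat.two_pow_pos n
  nlinarith

end ZeroErrorSolves

/-- Monotonicity of zero-error solvability in the class. [folklore] -/
theorem ZESolvableAt.mono {𝒞 𝒞' : ∀ n : ℕ, Set ((Fin n → Bool) → Bool)} {L : Language Bool} {n : ℕ}
    (h : ZESolvableAt 𝒞 L n) (h𝒞 : 𝒞 n ⊆ 𝒞' n) : ZESolvableAt 𝒞' L n := by
  obtain ⟨v, hv, d, hd, hs⟩ := h
  exact ⟨v, h𝒞 hv, d, h𝒞 hd, hs⟩

/-- Worst-case membership of the slice in a class containing the constant `true` gives zero-error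
solvability. [folklore] -/
theorem zeSolvableAt_of_mem {𝒞 : ∀ n : ℕ, Set ((Fin n → Bool) → Bool)} {L : Language Bool} {n : ℕ}
    (hL : ChenJinWilliams2020.sliceFn L n ∈ 𝒞 n) (hT : (fun _ => true) ∈ 𝒞 n) :
    ZESolvableAt 𝒞 L n :=
  ⟨_, hL, _, hT, ZeroErrorSolves.of_eq fun _ => rfl⟩

/-- Zero-error HARDNESS implies worst-case hardness (in a class containing the constant `true`):
the hypotheses of Thms. 1.9/1.10 are at least as strong as the corresponding worst-case lower
bounds at the same size. [folklore] -/
theorem not_mem_of_not_zeSolvableAt {𝒞 : ∀ n : ℕ, Set ((Fin n → Bool) → Bool)} {L : Language Bool}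
    {n : ℕ} (h : ¬ ZESolvableAt 𝒞 L n) (hT : (fun _ => true) ∈ 𝒞 n) :
    ChenJinWilliams2020.sliceFn L n ∉ 𝒞 n :=
  fun hL => h (zeSolvableAt_of_mem hL hT)

/-- Constant functions have one-gate `B₂`-circuits. [folklore] -/
theorem const_mem_b2CircuitFns {s : ℕ → ℕ} {n : ℕ} (hs : 1 ≤ s n) (b : Bool) :
    (fun _ => b) ∈ b2CircuitFns s n := by
  refine ⟨Circuit.const (Fin n) b, ⟨?_, ?_⟩, fun x => Circuit.eval_const b x⟩
  · intro g hg
    simp only [Circuit.const, List.mem_singleton] at hg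
    subst hg
    show (0 : ℕ) ≤ 2
    omega
  · simpa using hs

/-- `b2CircuitFns` is monotone in the size bound. [folklore] -/
theorem b2CircuitFns_mono {s s' : ℕ → ℕ} {n : ℕ} (h : s n ≤ s' n) :
    b2CircuitFns s n ⊆ b2CircuitFns s' n :=
  ChenJinWilliams2020.circuitFns_mono fun _ hC => ⟨hC.1, hC.2.trans h⟩

/-- The slice of the empty language is the constant `false`. [folklore] -/
theorem sliceFn_zero (n : ℕ) : ChenJinWilliams2020.sliceFn (0 : Language Bool) n = fun _ => false := by
  funext x
  simp only [ChenJinWilliams2020.sliceFn, Set.boolIndicator, ite_eq_right_iff, Bool.true_eq_false,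
    imp_false]
  exact fun h => h

/-- The empty language (the trivial `2^{n^β}`-sparse `NP` language) IS zero-error-solvable by
one-gate `B₂`-circuits — so it never witnesses the hypothesis of Thm. 1.9 (non-vacuity, F1).
[folklore] -/
theorem zeSolvableAt_zero_b2 {s : ℕ → ℕ} {n : ℕ} (hs : 1 ≤ s n) :
    ZESolvableAt (b2CircuitFns s) (0 : Language Bool) n := by
  rw [ZESolvableAt, sliceFn_zero]
  exact ⟨_, const_mem_b2CircuitFns hs false, _, const_mem_b2CircuitFns hs true,
    ZeroErrorSolves.of_eq fun _ => rfl⟩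

/-- The two-leaf De Morgan formula `g(x₀, ¬x₀)` on `n + 1` variables, `g ∈ {∧₂, ∨₂}` given by its
truth table `op` (used with `op = (GateFn.and 2).2` for the constant `false` and
`op = (GateFn.or 2).2` for the constant `true`). [folklore] -/
def twoLeaf (n : ℕ) (op : (Fin 2 → Bool) → Bool) : Circuit (Fin (n + 1)) where
  gates := [⟨1, fun w => !(w 0), fun _ => .inl 0⟩, ⟨2, op, ![.inl 0, .inr 0]⟩]
  output := .inr 1
  wf j h a m hm := by
    have hj : j = 0 ∨ j = 1 := by simp at h; omega
    rcases hj with rfl | rfl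
    · simp at hm
    · revert hm
      refine Fin.cases ?_ (fun i => ?_) a
      · simp
      · intro hm
        have hi : i = 0 := Fin.eq_zero i
        subst hi
        simp at hm
        omega
  wf_output m h := by cases h; simp

/-- `twoLeaf` is over the De Morgan basis when its binary gate is. [folklore] -/
theorem twoLeaf_isOver {n : ℕ} {op : (Fin 2 → Bool) → Bool}
    (hop : (⟨2, op⟩ : GateFn) ∈ deMorganBasis) : (twoLeaf n op).IsOver deMorganBasis := by
  intro g hg
  simp only [twoLeaf, List.mem_cons, List.not_mem_nil, or_false] at hg
  rcases hg with rfl | rfl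
  · right; right; rfl
  · exact hop

/-- `twoLeaf` is a formula (the negation gate is referenced once). [folklore] -/
theorem twoLeaf_isFormula (n : ℕ) (op : (Fin 2 → Bool) → Bool) : (twoLeaf n op).IsFormula := by
  intro m
  simp only [Circuit.refCount, twoLeaf, List.map_cons, List.map_nil, List.sum_cons, List.sum_nil,
    add_zero]
  have h1 : (univ.filter fun a : Fin 1 => (Sum.inl (0 : Fin (n + 1)) : Fin (n + 1) ⊕ ℕ).getRight? =
      some m).card = 0 := by simp
  have h2 : (univ.filter fun a : Fin 2 =>
      ((![Sum.inl (0 : Fin (n + 1)), Sum.inr 0] : Fin 2 → Fin (n + 1) ⊕ ℕ) a).getRight? = some m).card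
        ≤ 1 := by
    calc _ ≤ ({1} : Finset (Fin 2)).card := by
          apply Finset.card_le_card
          intro a ha
          simp only [Finset.mem_filter, Finset.mem_univ, true_and] at ha
          fin_cases a
          · simp at ha
          · simp
      _ = 1 := rfl
  omega

/-- `twoLeaf` has exactly two leaves. [folklore] -/
theorem twoLeaf_leafSize (n : ℕ) (op : (Fin 2 → Bool) → Bool) : (twoLeaf n op).leafSize = 2 := by
  simp [Circuit.leafSize, twoLeaf, List.ofFn_succ]

/-- `twoLeaf op` computes `op(x₀, ¬x₀)`. [folklore] -/
theorem twoLeaf_eval (n : ℕ) (op : (Fin 2 → Bool) → Bool) (x : Fin (n + 1) → Bool) :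
    (twoLeaf n op).eval x = op ![x 0, !x 0] := by
  simp only [Circuit.eval, Circuit.wireVals, twoLeaf, List.foldl_cons, List.foldl_nil,
    List.nil_append, List.getD_cons_zero, List.cons_append, List.getD_cons_succ]
  congr 1
  funext a
  refine Fin.cases ?_ (fun i => ?_) a
  · simp
  · have hi : i = 0 := Fin.eq_zero i
    subst hi
    simp

/-- The constants have two-leaf De Morgan formulas `x₀ ∧ ¬x₀`, `x₀ ∨ ¬x₀` (`n ≥ 1` variables,
leaf budget `≥ 2`). [folklore] -/
theorem const_mem_deMorganFormulaFns {s : ℕ → ℕ} {n : ℕ} (hs : 2 ≤ s (n + 1)) (b : Bool) :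
    (fun _ => b) ∈ ChenJinWilliams2020.deMorganFormulaFns s (n + 1) := by
  cases b
  · refine ⟨twoLeaf n (GateFn.and 2).2, ⟨twoLeaf_isOver (by left; rfl), twoLeaf_isFormula _ _,
      (twoLeaf_leafSize _ _).le.trans hs⟩, fun x => ?_⟩
    rw [twoLeaf_eval]
    cases x 0 <;> simp [GateFn.and]
  · refine ⟨twoLeaf n (GateFn.or 2).2, ⟨twoLeaf_isOver (by right; left; rfl), twoLeaf_isFormula _ _,
      (twoLeaf_leafSize _ _).le.trans hs⟩, fun x => ?_⟩
    rw [twoLeaf_eval]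
    cases x 0 <;> simp [GateFn.or]

/-- The empty language is zero-error-solvable by two-leaf De Morgan formulas (`n ≥ 1`).
[folklore] -/
theorem zeSolvableAt_zero_deMorgan {s : ℕ → ℕ} {n : ℕ} (hs : 2 ≤ s (n + 1)) :
    ZESolvableAt (ChenJinWilliams2020.deMorganFormulaFns s) (0 : Language Bool) (n + 1) := by
  rw [ZESolvableAt, sliceFn_zero]
  exact ⟨_, const_mem_deMorganFormulaFns hs false, _, const_mem_deMorganFormulaFns hs true,
    ZeroErrorSolves.of_eq fun _ => rfl⟩

/-! ### Theorem 1.9 — zero-error magnification for all sparse `NP` languages (𝒞 = Circuit, Formula) -/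

/-- The size shape "`O(n^ε)`": `n ↦ c·⌈n^ε⌉ + c` (cf. `superlinearBound`). [cite: ChenJinWilliams2019, Thm. 1.9 ("𝒞-circuits of size n^ε")] -/
noncomputable def sublinearBound (ε : ℝ) (c : ℕ) : ℕ → ℕ := fun n => c * powCeil ε n + c

/-- Hypothesis of **Thm. 1.9 at `ε`, `𝒞 = Circuit`, `C = NP`**: for every `β ∈ (0,1)` some
`2^{n^β}`-sparse `NP` language is NOT solvable on average with zero error by `B₂`-circuits of
`O(n^ε)` gates (for every constant `c`, at infinitely many lengths no value/flag pair of
`c⌈n^ε⌉ + c`-gate circuits zero-error-solves the slice). OPEN — a `Prop`, never asserted.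
[cite: ChenJinWilliams2019, Thm. 1.9 (hypothesis, 𝒞 = Circuit), TR19-118 p. 6] -/
def SparseNPZEHardCircuitAt (ε : ℝ) : Prop :=
  ∀ β : ℝ, 0 < β → β < 1 →
    ∃ L : Language Bool, L ∈ NP ∧ IsSparse (expSparsity β) L ∧
      ∀ c : ℕ, ¬ ∀ᶠ n in atTop, ZESolvableAt (b2CircuitFns (sublinearBound ε c)) L n

/-- **Chen–Jin–Williams 2019, Theorem 1.9, `𝒞 = Circuit` (`C = NP`).** Printed (p. 6): *"If there
is an ε > 0 and a family of languages {L_β} (indexed over β ∈ (0,1)) such that L_β is a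
2^{n^β}-sparse NP language not solvable on average with zero error by 𝒞-circuits of size n^ε for
all β, then NP ⊄ 𝒞[nᵏ] for all k."* Conclusion rendered as `NPNotInFixedPolySize`
(`SparseMagnification.lean`). Why implied by print: module docstring (i)–(iii).
[cite: ChenJinWilliams2019, Thm. 1.9 (𝒞 = Circuit), TR19-118 p. 6, proof p. 16–17] -/
def thm19_circuit_NP : Prop :=
  ∀ ε : ℝ, 0 < ε → SparseNPZEHardCircuitAt ε → NPNotInFixedPolySize

/-- Hypothesis of **Thm. 1.9 at `ε`, `𝒞 = Formula` (De Morgan, leaves), `C = NP`**.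
OPEN — a `Prop`, never asserted. [cite: ChenJinWilliams2019, Thm. 1.9 (hypothesis, 𝒞 = Formula), TR19-118 p. 6] -/
def SparseNPZEHardFormulaAt (ε : ℝ) : Prop :=
  ∀ β : ℝ, 0 < β → β < 1 →
    ∃ L : Language Bool, L ∈ NP ∧ IsSparse (expSparsity β) L ∧
      ∀ c : ℕ, ¬ ∀ᶠ n in atTop,
        ZESolvableAt (ChenJinWilliams2020.deMorganFormulaFns (sublinearBound ε c)) L n

/-- **Chen–Jin–Williams 2019, Theorem 1.9, `𝒞 = Formula` (`C = NP`)**: conclusion "NP ⊄ Formula[nᵏ]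
for all k" rendered as `ChenJinWilliams2020.NPNotInFixedPolyFormulas`.
[cite: ChenJinWilliams2019, Thm. 1.9 (𝒞 = Formula), TR19-118 p. 6] -/
def thm19_formula_NP : Prop :=
  ∀ ε : ℝ, 0 < ε → SparseNPZEHardFormulaAt ε → ChenJinWilliams2020.NPNotInFixedPolyFormulas

/-! ### Theorem 1.10 — zero-error magnification for `MCSP[s(m)]` and `MKtP[p(n)]` -/

/-- "`MCSP[s(m)]` on input length `n = 2^m` can be solved on average with zero error by
`Circuit[poly(s(m))]`", typed broadly: for some `k`, at all large `m`, a value/flag pair of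
`B₂`-circuits with `≤ s(m)ᵏ + k` gates zero-error-solves the slice of `MCSPSize s` at length `2^m`.
[cite: ChenJinWilliams2019, Thm. 1.10 (first bullet, solvability by 𝒞[poly(s(m))]), TR19-118 p. 6] -/
def MCSPZESolvableCircuit (s : ℕ → ℕ) : Prop :=
  ∃ k : ℕ, ∀ᶠ m : ℕ in atTop, ZESolvableAt (b2CircuitFns fun _ => s m ^ k + k) (MCSPSize s) (2 ^ m)

/-- The same with De Morgan formulas of `≤ s(m)ᵏ + k` leaves. [cite: ChenJinWilliams2019, Thm. 1.10 (first bullet, 𝒞 = Formula)] -/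
def MCSPZESolvableFormula (s : ℕ → ℕ) : Prop :=
  ∃ k : ℕ, ∀ᶠ m : ℕ in atTop,
    ZESolvableAt (ChenJinWilliams2020.deMorganFormulaFns fun _ => s m ^ k + k) (MCSPSize s) (2 ^ m)

/-- **Chen–Jin–Williams 2019, Theorem 1.10, first bullet, `𝒞 = Circuit`.** Printed (p. 6): *"Let
s(m) ≥ m. If MCSP[s(m)] on input length n = 2^m cannot be solved on average with zero error by
𝒞[poly(s(m))], then NP ⊄ 𝒞[poly(n)]."* Conclusion: `¬ (NP ⊆ PPoly)`.
[cite: ChenJinWilliams2019, Thm. 1.10 (MCSP bullet, 𝒞 = Circuit), TR19-118 p. 6, proof p. 17] -/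
def thm110_MCSP_circuit : Prop :=
  ∀ s : ℕ → ℕ, (∀ m, m ≤ s m) → ¬ MCSPZESolvableCircuit s → ¬ (NP ⊆ PPoly)

/-- **Chen–Jin–Williams 2019, Theorem 1.10, first bullet, `𝒞 = Formula`**: conclusion
"NP ⊄ Formula[poly]" rendered as `OliveiraSanthanam2018.NPNotInFormulaPoly`.
[cite: ChenJinWilliams2019, Thm. 1.10 (MCSP bullet, 𝒞 = Formula), TR19-118 p. 6] -/
def thm110_MCSP_formula : Prop :=
  ∀ s : ℕ → ℕ, (∀ m, m ≤ s m) → ¬ MCSPZESolvableFormula s → OliveiraSanthanam2018.NPNotInFormulaPoly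

section MKtP

variable (U : UniversalMachine)

/-- "`MKtP[p(n)]` can be solved on average with zero error by `Circuit[poly(p(n))]`", typed broadly
(as `MCSPZESolvableCircuit`), over the universal machine `U` of `LevinKt.lean`.
[cite: ChenJinWilliams2019, Thm. 1.10 (second bullet, solvability by 𝒞[poly(p(n))]), TR19-118 p. 6] -/
def MKtPZESolvableCircuit (p : ℕ → ℕ) : Prop :=
  ∃ k : ℕ, ∀ᶠ n : ℕ in atTop, ZESolvableAt (b2CircuitFns fun _ => p n ^ k + k) (U.MKtP p) n

/-- The same with De Morgan formulas. [cite: ChenJinWilliams2019, Thm. 1.10 (second bullet, 𝒞 = Formula)] -/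
def MKtPZESolvableFormula (p : ℕ → ℕ) : Prop :=
  ∃ k : ℕ, ∀ᶠ n : ℕ in atTop,
    ZESolvableAt (ChenJinWilliams2020.deMorganFormulaFns fun _ => p n ^ k + k) (U.MKtP p) n

/-- **Chen–Jin–Williams 2019, Theorem 1.10, second bullet, `𝒞 = Circuit`.** Printed (p. 6): *"Let
p(n) ≥ log n. If MKtP[p(n)] cannot be solved on average with zero error by 𝒞[poly(p(n))], then
EXP ⊄ 𝒞[poly(n)]."* Conclusion: `¬ (EXP ⊆ PPoly)`.
[cite: ChenJinWilliams2019, Thm. 1.10 (MKtP bullet, 𝒞 = Circuit), TR19-118 p. 6, proof p. 17] -/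
def thm110_MKtP_circuit : Prop :=
  ∀ p : ℕ → ℕ, (∀ n, Nat.clog 2 n ≤ p n) → ¬ MKtPZESolvableCircuit U p → ¬ (EXP ⊆ PPoly)

/-- "`EXP ⊄ Formula[poly]`": some `L ∈ EXP` lies outside `FORMULAae (m ↦ mᶜ)` for every `c` (the
`EXP` twin of `OliveiraSanthanam2018.NPNotInFormulaPoly`). [cite: ChenJinWilliams2019, Thm. 1.10 (conclusion EXP ⊄ 𝒞[poly(n)])] -/
def EXPNotInFormulaPoly : Prop :=
  ∃ L ∈ EXP, ∀ c : ℕ, L ∉ FORMULAae fun m => m ^ c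

/-- **Chen–Jin–Williams 2019, Theorem 1.10, second bullet, `𝒞 = Formula`.**
[cite: ChenJinWilliams2019, Thm. 1.10 (MKtP bullet, 𝒞 = Formula), TR19-118 p. 6] -/
def thm110_MKtP_formula : Prop :=
  ∀ p : ℕ → ℕ, (∀ n, Nat.clog 2 n ≤ p n) → ¬ MKtPZESolvableFormula U p → EXPNotInFormulaPoly

end MKtP

/-! ### Packaging (proved) -/

/-- Thm. 1.9 (`𝒞 = Circuit`) applied. [cite: ChenJinWilliams2019, Thm. 1.9] -/
theorem npNotInFixedPolySize_of_zeHard (hT : thm19_circuit_NP) {ε : ℝ} (hε : 0 < ε)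
    (hH : SparseNPZEHardCircuitAt ε) : NPNotInFixedPolySize :=
  hT ε hε hH

/-- Thm. 1.10 (MCSP bullet, `𝒞 = Circuit`) applied. [cite: ChenJinWilliams2019, Thm. 1.10] -/
theorem not_NP_subset_PPoly_of_MCSP_zeHard (hT : thm110_MCSP_circuit) {s : ℕ → ℕ}
    (hs : ∀ m, m ≤ s m) (hH : ¬ MCSPZESolvableCircuit s) : ¬ (NP ⊆ PPoly) :=
  hT s hs hH

/-- Antitonicity of the Thm. 1.9 hypothesis in `ε` (smaller size classes are easier to be hard
against). [folklore] -/
theorem SparseNPZEHardCircuitAt.anti {ε ε' : ℝ} (hε' : 0 < ε') (h : ε' ≤ ε)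
    (hH : SparseNPZEHardCircuitAt ε) : SparseNPZEHardCircuitAt ε' := by
  intro β hβ hβ1
  obtain ⟨L, hNP, hsp, hhard⟩ := hH β hβ hβ1
  refine ⟨L, hNP, hsp, fun c hc => hhard c (hc.mono fun n hn => hn.mono (b2CircuitFns_mono ?_))⟩
  simp only [sublinearBound]
  have := powCeil_mono hε' h n
  nlinarith

/-- Zero-error solvability with a polynomial budget is monotone in the parameter exponent: useful
bookkeeping (`k ≤ k'`). [folklore] -/
theorem MCSPZESolvableCircuit.of_le {s : ℕ → ℕ} {k k' : ℕ} (hk : k ≤ k')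
    (h : ∀ᶠ m : ℕ in atTop, ZESolvableAt (b2CircuitFns fun _ => s m ^ k + k) (MCSPSize s) (2 ^ m))
    (hs : ∀ m, 1 ≤ s m) : MCSPZESolvableCircuit s := by
  refine ⟨k', h.mono fun m hm => hm.mono (b2CircuitFns_mono ?_)⟩
  have : s m ^ k ≤ s m ^ k' := Nat.pow_le_pow_right (hs m) hk
  omega

end Literature.Computability.MetaComplexity.ChenJinWilliams2019
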